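import Literature.MathematicalPhysics.QuantumLattice.MPSBlockedTensorSweep
import Summits.Ventures.CertifiedManyBodySolver.Upper.UMPSPolarTensor
import HarnessLib

/-!
# Strip-cell certificates, bridge layer L3: the tree's `heisenberg` / `bondImage` / integer twins
# are operator-weighted sweeps, and sweeps of BLOCKED cell tensors factorise site by site

HONEST FRAMING: first certified bounds; not a superconductivity verdict; every number certified or
labelled float. This file is pure tensor algebra (zero row value); it is the format-independent core
of lemma group (L3) of the sr-mbsolver «FORMAT-soundness bridge» (HOME
`hubbard-upper-eng-1/eng-g26/BRIDGE-SPEC.md`): the step that lets a kernel-replayed strip-cell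
certificate (`Theorems/M3x2EdgeSplitUpperEdgePilotCellW4D32*`, whose verifier evaluates the dual
matrix by per-site SWEEPS over the in-cell sites) be compared with the tree's DENSE objects
`Upper.heisenberg`, `Upper.bondImage`, `Upper.dualMatrix` (route `M3x2EdgeSplit`, crux
`UpperEdge_le_m73o100`, consumer `Theorems.energyDensityTT'_le_of_exists_stripCellCert₂`).

With `opSandwich A O M = Σ_{s t} O_{st} (A^s)ᴴ M A^t` and `consTensor A B (s,u) = A^s B^u`
(`Literature.MathematicalPhysics.QuantumLattice.MPSBlockedTensorSweep`):

* `heisenberg_eq_opSandwich`, `gram_eq_opSandwich`, `bondImage_eq_opSandwich` — the tree's `Φ(B)`,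
  `G` and `Y_X` are sweeps (`O = 1`; the bond image is the sweep of the blocked PAIR tensor);
* `bondImage_kronecker` — for a product two-site matrix, `Y_{O ⊗ P} = Φ^P(Φ^O(1))`: the bond image
  is TWO one-site sweeps, the left factor innermost;
* `heisenberg_consTensor`, `bondImage_consTensor_kronecker` — for a cell tensor that is itself a
  block of two site tensors `k₁` (left, bonds `D → β`) and `k₀` (right, bonds `β → D`) read through
  any enumeration `e : Fin Q ≃ σ × τ` of the cell alphabet, `Φ` is two sweeps and the bond image of a
  product-of-products word is FOUR sweeps (rectangular intermediate bond `β`); iterate for `N` sites;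
* (companion file `M3x2EdgeSplitUpperEdgeCellSweepTwins`: the same for the integer twins of
  `UMPSKernelTwins`, and reading an integer sweep in `ℂ` via `castC`.)

Nothing here is specific to the Hubbard cell Hamiltonian (that is lemma group (L4): writing
`stripCellBondMatrix` as a sum of product words in the `stripCellEnum` alphabet) and nothing is a
claim node. 0 `sorry`, 0 `def`.
-/

namespace Summit.Ventures.CertifiedManyBodySolver.Theorems

open Matrix Literature.MathematicalPhysics.QuantumLattice Summit.Ventures.CertifiedManyBodySolver.Upper
open scoped Kronecker

section Dense

variable {q D : ℕ}

/-- The tree's Heisenberg map `Φ(B) = Σ_s (A s)ᴴ B (A s)` is the `O = 1` sweep. -/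
theorem heisenberg_eq_opSandwich (A : MPSTensor q D) (B : Matrix (Fin D) (Fin D) ℂ) :
    heisenberg A B = opSandwich A 1 B :=
  (opSandwich_one A B).symm

/-- The tree's Gram matrix `G = Σ_s (A s)ᴴ (A s)` is the `O = 1` sweep of the identity. -/
theorem gram_eq_opSandwich (A : MPSTensor q D) : Upper.gram A = opSandwich A 1 1 := by
  rw [opSandwich_one, Upper.gram]
  simp only [Matrix.mul_one]

/-- The tree's bond image `Y_X = Σ_{p p'} X_{pp'} (A p₁ A p₂)ᴴ (A p'₁ A p'₂)` is the `X`-weighted sweep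
of the blocked PAIR tensor `consTensor A A` applied to the identity. -/
theorem bondImage_eq_opSandwich (A : MPSTensor q D) (X : Matrix (Fin q × Fin q) (Fin q × Fin q) ℂ) :
    bondImage A X = opSandwich (consTensor A A) X 1 := by
  rw [bondImage, opSandwich_def]
  simp only [consTensor_apply, Matrix.mul_one]

/-- **Two sweeps.** For a product two-site matrix the bond image is the right-site sweep of the
left-site sweep of the identity: `Y_{O ⊗ₖ P} = Φ^P(Φ^O(1))`. -/
theorem bondImage_kronecker (A : MPSTensor q D) (O P : Matrix (Fin q) (Fin q) ℂ) :
    bondImage A (O ⊗ₖ P) = opSandwich A P (opSandwich A O 1) := by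
  rw [bondImage_eq_opSandwich, opSandwich_consTensor_kronecker]

/-- `Y_{O ⊗ₖ 1} = Φ(Φ^O(1))` — an operator supported on the LEFT site of the bond costs one weighted
and one plain sweep (NOT `Φ^O(1)` alone unless `A` is exactly isometric and `Φ^O(1)` is `Φ`-fixed). -/
theorem bondImage_kronecker_one (A : MPSTensor q D) (O : Matrix (Fin q) (Fin q) ℂ) :
    bondImage A (O ⊗ₖ (1 : Matrix (Fin q) (Fin q) ℂ)) = heisenberg A (opSandwich A O 1) := by
  rw [bondImage_kronecker, heisenberg_eq_opSandwich]

/-- `Y_{1 ⊗ₖ P} = Φ^P(G)` — an operator supported on the RIGHT site of the bond is one weighted sweep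
of the Gram matrix. -/
theorem bondImage_one_kronecker (A : MPSTensor q D) (P : Matrix (Fin q) (Fin q) ℂ) :
    bondImage A ((1 : Matrix (Fin q) (Fin q) ℂ) ⊗ₖ P) = opSandwich A P (Upper.gram A) := by
  rw [bondImage_kronecker, gram_eq_opSandwich]

end Dense

section Cell

variable {Q D : ℕ} {σ τ β : Type*} [Fintype σ] [Fintype τ] [Fintype β]

/-- **A blocked cell tensor: `Φ` is two sweeps.** If the cell tensor is the block of a left site
tensor `k₁` and a right site tensor `k₀` (intermediate bond `β`, any size) read through an
enumeration `e` of the cell alphabet, then `Φ(Z) = Φ_{k₀}(Φ_{k₁}(Z))`. -/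
theorem heisenberg_consTensor [DecidableEq σ] [DecidableEq τ] (k₁ : σ → Matrix (Fin D) β ℂ)
    (k₀ : τ → Matrix β (Fin D) ℂ) (e : Fin Q ≃ σ × τ) (Z : Matrix (Fin D) (Fin D) ℂ) :
    heisenberg (fun S => consTensor k₁ k₀ (e S)) Z = opSandwich k₀ 1 (opSandwich k₁ 1 Z) := by
  rw [heisenberg_eq_opSandwich, ← opSandwich_consTensor_kronecker, one_kronecker_one,
    ← opSandwich_reindex e (consTensor k₁ k₀) 1 Z, submatrix_one_equiv]

/-- **A blocked cell tensor: the bond image of a product word is four sweeps.** With the cell tensor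
as in `heisenberg_consTensor` and the two-cell matrix `X = (O₁ ⊗ₖ O₀) ⊗ₖ (P₁ ⊗ₖ P₀)` (each cell
factor a product of one-site factors, read through `e`),
`Y_X = Φ^{P₀}_{k₀}(Φ^{P₁}_{k₁}(Φ^{O₀}_{k₀}(Φ^{O₁}_{k₁}(1))))` — left cell innermost, and inside each
cell the left site innermost. This is the evaluation order of a sweep-organised certificate verifier;
`N`-site cells iterate it (`consTensor_assoc`, `opSandwich_reindex`). -/
theorem bondImage_consTensor_kronecker (k₁ : σ → Matrix (Fin D) β ℂ) (k₀ : τ → Matrix β (Fin D) ℂ)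
    (e : Fin Q ≃ σ × τ) (O₁ P₁ : Matrix σ σ ℂ) (O₀ P₀ : Matrix τ τ ℂ) :
    bondImage (fun S => consTensor k₁ k₀ (e S)) (((O₁ ⊗ₖ O₀).submatrix e e) ⊗ₖ ((P₁ ⊗ₖ P₀).submatrix e e)) =
      opSandwich k₀ P₀ (opSandwich k₁ P₁ (opSandwich k₀ O₀ (opSandwich k₁ O₁ 1))) := by
  rw [bondImage_kronecker]
  have h : ∀ (O : Matrix σ σ ℂ) (P : Matrix τ τ ℂ) (M : Matrix (Fin D) (Fin D) ℂ),
      opSandwich (fun S => consTensor k₁ k₀ (e S)) ((O ⊗ₖ P).submatrix e e) M =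
        opSandwich k₀ P (opSandwich k₁ O M) := fun O P M => by
    rw [opSandwich_reindex e (consTensor k₁ k₀) (O ⊗ₖ P) M, opSandwich_consTensor_kronecker]
  rw [h, h]

end Cell


end Summit.Ventures.CertifiedManyBodySolver.Theorems
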